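import Mathlib.Tactic
import HarnessLib

/-!
# Kozma–Nitzan's Question 8 — UB(Ψ̂): the truncated-average form of the bracket and the contraction induction (gen 45)

Support file (`--supports stmt-CriticalPhenomena-4575`, closed crux; independent mathematics on Kozma–Nitzan's Question 8,
arXiv:2401.12397 §5.5 p. 36), prover `prim-ineq-gen-6` (gen 45).  No definitions, no named facts, no sorries; standard axioms.
Memo `run/shared/lean/prim/prim-ineq-gen-6/PROOF-UBD2-G45.md` §4.

THEOREM UB(Ψ̂) (`Ψ̂_j ≤ c·μ̂^_j` at every class) follows, by the THEOREM-UB induction of gen 28, from the brackets `K^ψ_j ≥ 0`.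
Gen 45 shows (exact identity, asserted on 3 600 classes) that the bracket is a TRUNCATED CLASS AVERAGE of the per-class slack
`φ_k := c·μ̂_k − ψ_k`:  `S_{j+1}·K^ψ_j = Σ_{k<j} ω_k φ_k + S_j φ_j` (`ω_k` the class masses, `S_j = Σ_{k≥j} ω_k`).  At `j = 1` this is the
abstract bracket identity `kBracket_one` below (it uses only `p₀ = (1−s₂)M p₁ + s₂Φ₂` and `Δ₁₀ = M p₁ − Φ₂`).  The top case `j = n−1` is the
zero-mass identity `kTop_identity` (`Σ ω φ = c·m + τ₁`).  CONTRACTING the first edge (`T′ = T₁[a₀,γ₀]`; `ω_k = s₁ω′_{k−1}`, `φ′_{k−1} = φ_k|_{s₁=1}`)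
turns the all-`j` statement into an induction whose step is the per-class inequality `(1−s₁)φ₀ + s₁(φ_k − φ′_{k−1}) ≥ 0`
(`kE_contraction_step`, `kE_induction`; CONJECTURE ℓ of the memo, census/climb-clean on blocks with `c > 0`).
[cite: KozmaNitzan2024, Question 8 (§5.5 p. 36)]
-/

namespace Summit.CriticalPhenomena.PercolationContinuityZ3.Theorems

namespace PocketCert

open Finset in
/-- **Contraction step.**  If the capped masses `w k ≥ 0` (`k ∈ [1,j]`) sum to `1`, `0 ≤ s`, and the per-class inequality
`(1−s)·φ₀ + s·(φ k − φ' k) ≥ 0` holds for every `k ∈ [1,j]`, then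
`E := (1−s)·φ₀ + s·Σ_{k∈[1,j]} w k·φ k ≥ s·Σ_{k∈[1,j]} w k·φ' k =: s·E′`.  [cite: KozmaNitzan2024, Question 8 (§5.5 p. 36)] -/
theorem kE_contraction_step (j : ℕ) (s φ0 : ℝ) (w φ φ' : ℕ → ℝ)
    (hw : ∀ k ∈ Icc 1 j, 0 ≤ w k) (hsum : ∑ k ∈ Icc 1 j, w k = 1)
    (hl : ∀ k ∈ Icc 1 j, 0 ≤ (1 - s) * φ0 + s * (φ k - φ' k)) :
    s * ∑ k ∈ Icc 1 j, w k * φ' k ≤ (1 - s) * φ0 + s * ∑ k ∈ Icc 1 j, w k * φ k := by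
  have key : (1 - s) * φ0 + s * ∑ k ∈ Icc 1 j, w k * φ k - s * ∑ k ∈ Icc 1 j, w k * φ' k
      = ∑ k ∈ Icc 1 j, w k * ((1 - s) * φ0 + s * (φ k - φ' k)) := by
    have e2 : ∑ k ∈ Icc 1 j, w k * ((1 - s) * φ0 + s * (φ k - φ' k))
        = ∑ k ∈ Icc 1 j, (w k * ((1 - s) * φ0) + (s * (w k * φ k) - s * (w k * φ' k))) := by
      apply sum_congr rfl; intro k _; ring
    rw [e2, sum_add_distrib, sum_sub_distrib, ← sum_mul, ← mul_sum, ← mul_sum, hsum]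
    ring
  have hnn : 0 ≤ ∑ k ∈ Icc 1 j, w k * ((1 - s) * φ0 + s * (φ k - φ' k)) :=
    sum_nonneg (fun k hk => mul_nonneg (hw k hk) (hl k hk))
  linarith [key, hnn]

open Finset in
/-- **Induction corollary.**  Under the hypotheses of `kE_contraction_step`, if moreover the contracted truncated average is nonnegative
(`Σ w k·φ' k ≥ 0`, the induction hypothesis for `T′`), then `E = (1−s)φ₀ + s·Σ w k·φ k ≥ 0`.  [cite: KozmaNitzan2024, Question 8 (§5.5 p. 36)] -/
theorem kE_induction (j : ℕ) (s φ0 : ℝ) (w φ φ' : ℕ → ℝ) (hs : 0 ≤ s)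
    (hw : ∀ k ∈ Icc 1 j, 0 ≤ w k) (hsum : ∑ k ∈ Icc 1 j, w k = 1)
    (hl : ∀ k ∈ Icc 1 j, 0 ≤ (1 - s) * φ0 + s * (φ k - φ' k)) (hIH : 0 ≤ ∑ k ∈ Icc 1 j, w k * φ' k) :
    0 ≤ (1 - s) * φ0 + s * ∑ k ∈ Icc 1 j, w k * φ k := by
  have h := kE_contraction_step j s φ0 w φ φ' hw hsum hl
  have : 0 ≤ s * ∑ k ∈ Icc 1 j, w k * φ' k := mul_nonneg hs hIH
  linarith

/-- **The bracket at depth 1 is the `s₁`-mixture of the two per-class values** (abstract form of the gen-45 identity at `j = 1`).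
With the tree ratio `r₀₁` (`r₀₁·s₁p₀ = (1−s₁)M p₁`), the reduction coefficient `c₁₀` (`c₁₀·p₀ = (1−s₁)Δ`), `Δ = M p₁ − Φ₂` and the suffix relation
`p₀ = (1−s₂)M p₁ + s₂Φ₂` (`M = M(A₁,C₁)`, `Φ₂ = Φ(T₂[A₁,C₁])`), the bracket `K` of a class function `f` defined by
`−ω₁·(f₁ + r₀₁f₀) = s₂(1−s₂)·(s₁·K − c₁₀·f₀)` (`ω₁ = s₁(1−s₂)`) satisfies `s₁s₂·K = −(s₁f₁ + (1−s₁)f₀)`.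
[cite: KozmaNitzan2024, Question 8 (§5.5 p. 36)] -/
theorem kBracket_one (s1 s2 p0 p1 M Φ2 Δ f0 f1 r01 c10 K : ℝ) (hs1 : s1 ≠ 0) (hs2' : 1 - s2 ≠ 0) (hp0 : p0 ≠ 0)
    (hp : p0 = (1 - s2) * M * p1 + s2 * Φ2) (hΔ : Δ = M * p1 - Φ2)
    (hr : r01 * (s1 * p0) = (1 - s1) * M * p1) (hc : c10 * p0 = (1 - s1) * Δ)
    (hK : -(s1 * (1 - s2)) * (f1 + r01 * f0) = s2 * (1 - s2) * (s1 * K - c10 * f0)) :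
    s1 * s2 * K = -(s1 * f1 + (1 - s1) * f0) := by
  have h3 : s1 * (1 - s2) * p0 * (s1 * s2 * K + (s1 * f1 + (1 - s1) * f0)) = 0 := by
    linear_combination (-(s1 * p0)) * hK + (-(s1 * (1 - s2) * f0)) * hr + (s1 * (1 - s2) * f0 * s2) * hc
      + (s1 * (1 - s2) * f0 * (1 - s1) * s2) * hΔ + (s1 * (1 - s2) * f0 * (1 - s1)) * hp
  have hne : s1 * (1 - s2) * p0 ≠ 0 := mul_ne_zero (mul_ne_zero hs1 hs2') hp0
  have h4 : s1 * s2 * K + (s1 * f1 + (1 - s1) * f0) = 0 := by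
    rcases mul_eq_zero.mp h3 with h | h
    · exact absurd h hne
    · exact h
  linarith

open Finset in
/-- **Top identity (zero mass).**  If `Σ_k ω_k (x_k + ψ_k) = 0` (zero mass of the class density `G₀ = x + ψ`) and `Σ_k ω_k μ̂_k = m`,
then the full class average of the slack `φ = c·μ̂ − ψ` is `Σ_k ω_k φ_k = c·m + Σ_k ω_k x_k = c·m + τ₁`.
[cite: KozmaNitzan2024, Question 8 (§5.5 p. 36)] -/
theorem kTop_identity (n : ℕ) (ω x ψ μ : ℕ → ℝ) (c m : ℝ)
    (hzero : ∑ k ∈ range n, ω k * (x k + ψ k) = 0) (hm : ∑ k ∈ range n, ω k * μ k = m) :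
    ∑ k ∈ range n, ω k * (c * μ k - ψ k) = c * m + ∑ k ∈ range n, ω k * x k := by
  have e : ∑ k ∈ range n, ω k * (c * μ k - ψ k)
      = c * ∑ k ∈ range n, ω k * μ k - (∑ k ∈ range n, ω k * (x k + ψ k)) + ∑ k ∈ range n, ω k * x k := by
    rw [mul_sum, ← sum_sub_distrib, ← sum_add_distrib]
    apply sum_congr rfl; intro k _; ring
  rw [e, hm, hzero]; ring

end PocketCert

end Summit.CriticalPhenomena.PercolationContinuityZ3.Theorems
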